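import Mathlib
import Summits.Ventures.HodgeRepro.Tier4.Common.HeckeInvariance

/-!
# Tier4/Common/HeckeCoeff — the Hecke elements acting on the `2`-forms of `X_{Γ′}`

Blind re-derivation cell `pub-hodge-repro`, Tier 4 (README §9–§10), seat t4-typer-1 (gen 0).  Target tree path
`lean/Summits/Ventures/HodgeRepro/Tier4/Common/HeckeCoeff.lean`.  Imports `Tier4/Common/HeckeInvariance.lean`
(typer-1: the group facts, `pullField_act_act`, the coset-representative permutation for `1`-forms).

WHAT IS DEFINED.  `heckeCoeffSum d h k z = Σ_terms c • Σ_{r ∈ R} (act r)^* k (z)` with the `2`-form pull-back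
`pullCoeff`, and `heckeCoeff d h k = ball.indicator (heckeCoeffSum d h k)` — the Hecke translate of a `2`-form
coefficient of `X_{Γ′}`, the exact analogue of `heckeSum` / `heckeField` for `1`-forms.

WHAT IS PROVED.  `jacDetMap_comp` (multiplicativity of the Jacobian determinant, from `jacMat_comp`),
`pullCoeff_congr`, `pullCoeff_act_act` (functoriality on the ball), linearity of `heckeCoeff`, the one-term
invariance `pullCoeff_act_sum_reps` (the same coset-representative permutation as for `1`-forms) and
**`heckeCoeff_isAutForm2`**: a Hecke element of level `Γ′` carries `2`-forms of `X_{Γ′}` to `2`-forms of `X_{Γ′}`.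

Nothing here says anything about the status of the Hodge conjecture for CM abelian varieties, which is NOT proved
(HC_CM is NOT proved by anyone in this repository).
-/

set_option autoImplicit false

noncomputable section

open Matrix MeasureTheory NumberField
open scoped ComplexConjugate ComplexOrder

namespace Summit.Ventures.HodgeRepro.Tier4

/-- **Multiplicativity of the Jacobian determinant**: `jacDetMap (φ ∘ ψ) z = jacDetMap φ (ψ z) * jacDetMap ψ z`. -/
theorem jacDetMap_comp {φ ψ : (Fin 2 → ℂ) → (Fin 2 → ℂ)} {z : Fin 2 → ℂ} (hφ : DifferentiableAt ℂ φ (ψ z))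
    (hψ : DifferentiableAt ℂ ψ z) : jacDetMap (φ ∘ ψ) z = jacDetMap φ (ψ z) * jacDetMap ψ z := by
  rw [← det_jacMat, ← det_jacMat, ← det_jacMat, jacMat_comp hφ hψ, Matrix.det_mul]

/-- Two maps that agree near `z` have the same Jacobian determinant at `z`. -/
theorem jacDetMap_congr {φ ψ : (Fin 2 → ℂ) → (Fin 2 → ℂ)} {z : Fin 2 → ℂ} (h : φ =ᶠ[nhds z] ψ) :
    jacDetMap φ z = jacDetMap ψ z := by
  rw [← det_jacMat, ← det_jacMat]
  congr 1
  ext j k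
  simp only [jacMat, pd]
  have hj : (fun w => φ w j) =ᶠ[nhds z] fun w => ψ w j := h.mono fun w hw => by simp [hw]
  rw [hj.fderiv_eq]

/-- Two maps that agree near `z` have the same `2`-form pull-back at `z`. -/
theorem pullCoeff_congr {φ ψ : (Fin 2 → ℂ) → (Fin 2 → ℂ)} {z : Fin 2 → ℂ} (h : φ =ᶠ[nhds z] ψ)
    (k : (Fin 2 → ℂ) → ℂ) : pullCoeff φ k z = pullCoeff ψ k z := by
  simp only [pullCoeff, h.eq_of_nhds, jacDetMap_congr h]

/-- Functoriality of the `2`-form pull-back: `ψ^*(φ^*k) = (φ ∘ ψ)^*k` at a point. -/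
theorem pullCoeff_comp {φ ψ : (Fin 2 → ℂ) → (Fin 2 → ℂ)} (k : (Fin 2 → ℂ) → ℂ) {z : Fin 2 → ℂ}
    (hφ : DifferentiableAt ℂ φ (ψ z)) (hψ : DifferentiableAt ℂ ψ z) :
    pullCoeff ψ (pullCoeff φ k) z = pullCoeff (φ ∘ ψ) k z := by
  simp only [pullCoeff, Function.comp]
  rw [jacDetMap_comp hφ hψ, mul_assoc]

/-- The `2`-form pull-back is additive in the coefficient. -/
theorem pullCoeff_add (φ : (Fin 2 → ℂ) → (Fin 2 → ℂ)) (k k' : (Fin 2 → ℂ) → ℂ) :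
    pullCoeff φ (k + k') = pullCoeff φ k + pullCoeff φ k' := by
  funext z; simp [pullCoeff, add_mul]

/-- The `2`-form pull-back is homogeneous in the coefficient. -/
theorem pullCoeff_smul (φ : (Fin 2 → ℂ) → (Fin 2 → ℂ)) (c : ℂ) (k : (Fin 2 → ℂ) → ℂ) :
    pullCoeff φ (c • k) = c • pullCoeff φ k := by
  funext z; simp [pullCoeff, mul_assoc]

/-- The `2`-form pull-back of zero is zero. -/
theorem pullCoeff_zero (φ : (Fin 2 → ℂ) → (Fin 2 → ℂ)) : pullCoeff φ (0 : (Fin 2 → ℂ) → ℂ) = 0 := by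
  funext z; simp [pullCoeff]

/-- The `2`-form pull-back of an integer multiple. -/
theorem pullCoeff_zsmul (φ : (Fin 2 → ℂ) → (Fin 2 → ℂ)) (n : ℤ) (k : (Fin 2 → ℂ) → ℂ) (z : Fin 2 → ℂ) :
    pullCoeff φ (n • k) z = n • pullCoeff φ k z := by
  simp only [pullCoeff, Pi.smul_apply, zsmul_eq_mul, mul_assoc]

namespace TargetData

variable {F E : Type} [Field F] [NumberField F] [IsGalois ℚ F] [IsCMField F]
  [Field E] [NumberField E] [IsGalois ℚ E] [IsCMField E] (d : TargetData F E)

/-- **The Hecke sum of a `2`-form coefficient**: `Σ_terms c • Σ_{r ∈ R} (act r)^* k (z)`. -/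
def heckeCoeffSum (h : HeckeElement E) (k : (Fin 2 → ℂ) → ℂ) : (Fin 2 → ℂ) → ℂ :=
  fun z => (h.terms.map fun t => t.1 • (t.2.sum fun r => pullCoeff (d.act r) k z)).sum

/-- **The Hecke translate of a `2`-form coefficient of `X_{Γ′}`**: the Hecke sum on the ball, zero outside. -/
def heckeCoeff (h : HeckeElement E) (k : (Fin 2 → ℂ) → ℂ) : (Fin 2 → ℂ) → ℂ :=
  ball.indicator (d.heckeCoeffSum h k)

/-- On the ball the Hecke translate is the Hecke sum. -/
theorem heckeCoeff_of_mem (h : HeckeElement E) (k : (Fin 2 → ℂ) → ℂ) {z : Fin 2 → ℂ} (hz : z ∈ ball) :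
    d.heckeCoeff h k z = d.heckeCoeffSum h k z :=
  Set.indicator_of_mem hz _

/-- Outside the ball the Hecke translate vanishes. -/
theorem heckeCoeff_of_not_mem (h : HeckeElement E) (k : (Fin 2 → ℂ) → ℂ) {z : Fin 2 → ℂ} (hz : z ∉ ball) :
    d.heckeCoeff h k z = 0 :=
  Set.indicator_of_notMem hz _

/-- The Hecke sum of a term and the rest, as functions. -/
theorem heckeCoeffSum_cons_fun (t : ℤ × Finset (Matrix (Fin 3) (Fin 3) E))
    (ts : List (ℤ × Finset (Matrix (Fin 3) (Fin 3) E))) (k : (Fin 2 → ℂ) → ℂ) :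
    d.heckeCoeffSum ⟨t :: ts⟩ k = (t.1 • fun w => ∑ r ∈ t.2, pullCoeff (d.act r) k w) + d.heckeCoeffSum ⟨ts⟩ k := by
  funext z
  simp [heckeCoeffSum]

/-- Additivity in the coefficient. -/
theorem heckeCoeffSum_add (h : HeckeElement E) (k k' : (Fin 2 → ℂ) → ℂ) :
    d.heckeCoeffSum h (k + k') = d.heckeCoeffSum h k + d.heckeCoeffSum h k' := by
  funext z
  simp only [heckeCoeffSum, pullCoeff_add, Pi.add_apply, Finset.sum_add_distrib, smul_add]
  rw [← List.sum_map_add]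

/-- Homogeneity in the coefficient. -/
theorem heckeCoeffSum_smul (h : HeckeElement E) (a : ℂ) (k : (Fin 2 → ℂ) → ℂ) :
    d.heckeCoeffSum h (a • k) = a • d.heckeCoeffSum h k := by
  funext z
  simp only [heckeCoeffSum, pullCoeff_smul, Pi.smul_apply]
  rw [List.smul_sum, List.map_map]
  congr 1
  refine List.map_congr_left fun t _ => ?_
  simp only [Function.comp, ← Finset.smul_sum]
  rw [smul_comm]

/-- The zero coefficient is fixed. -/
theorem heckeCoeffSum_zero (h : HeckeElement E) : d.heckeCoeffSum h (0 : (Fin 2 → ℂ) → ℂ) = 0 := by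
  funext z
  simp [heckeCoeffSum, pullCoeff_zero]

/-- Additivity of the Hecke translate. -/
theorem heckeCoeff_add (h : HeckeElement E) (k k' : (Fin 2 → ℂ) → ℂ) :
    d.heckeCoeff h (k + k') = d.heckeCoeff h k + d.heckeCoeff h k' := by
  unfold heckeCoeff
  rw [d.heckeCoeffSum_add]
  funext z
  by_cases hz : z ∈ ball <;> simp [hz]

/-- Homogeneity of the Hecke translate. -/
theorem heckeCoeff_smul (h : HeckeElement E) (a : ℂ) (k : (Fin 2 → ℂ) → ℂ) :
    d.heckeCoeff h (a • k) = a • d.heckeCoeff h k := by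
  unfold heckeCoeff
  rw [d.heckeCoeffSum_smul]
  funext z
  by_cases hz : z ∈ ball <;> simp [hz]

/-- The Hecke translate of zero is zero. -/
theorem heckeCoeff_zero (h : HeckeElement E) : d.heckeCoeff h (0 : (Fin 2 → ℂ) → ℂ) = 0 := by
  unfold heckeCoeff
  rw [d.heckeCoeffSum_zero]
  funext z
  by_cases hz : z ∈ ball <;> simp [hz]

/-- Functoriality on the ball for `2`-forms: `(act δ)^*((act γ)^* k) = (act (γ δ))^* k`, `γ, δ` unitary. -/
theorem pullCoeff_act_act {γ δ : Matrix (Fin 3) (Fin 3) E} (hγ : IsUnitaryOf (conjE E) d.H γ)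
    (hδ : IsUnitaryOf (conjE E) d.H δ) (k : (Fin 2 → ℂ) → ℂ) {z : Fin 2 → ℂ} (hz : z ∈ ball) :
    pullCoeff (d.act δ) (pullCoeff (d.act γ) k) z = pullCoeff (d.act (γ * δ)) k z := by
  rw [pullCoeff_comp k (d.differentiableAt_act_of_unitary hγ (d.act_mem_ball_of_unitary hδ hz))
    (d.differentiableAt_act_of_unitary hδ hz), pullCoeff_congr (d.act_mul_eventuallyEq hδ hz)]

/-- The `2`-form pull-back commutes with a finite sum. -/
theorem pullCoeff_act_finset_sum {δ : Matrix (Fin 3) (Fin 3) E} (R : Finset (Matrix (Fin 3) (Fin 3) E))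
    (k : (Fin 2 → ℂ) → ℂ) (z : Fin 2 → ℂ) :
    pullCoeff (d.act δ) (fun w => ∑ r ∈ R, pullCoeff (d.act r) k w) z =
      ∑ r ∈ R, pullCoeff (d.act δ) (pullCoeff (d.act r) k) z := by
  simp only [pullCoeff, Finset.sum_mul]

/-- **The one-term invariance for `2`-forms**: `Σ_{r ∈ R} (act r)^* k` is `δ`-invariant on the ball for `δ ∈ Γ′`. -/
theorem pullCoeff_act_sum_reps {Γ' : Set (Matrix (Fin 3) (Fin 3) E)} (hΓ' : IsCongruenceSubgroup (conjE E) d.H Γ')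
    {g : Matrix (Fin 3) (Fin 3) E} (hg : IsUnitaryOf (conjE E) d.H g) {R : Finset (Matrix (Fin 3) (Fin 3) E)}
    (hR : IsCosetReps Γ' g R) {k : (Fin 2 → ℂ) → ℂ} (hk : d.IsAutForm2 Γ' k)
    {δ : Matrix (Fin 3) (Fin 3) E} (hδ : δ ∈ Γ') {z : Fin 2 → ℂ} (hz : z ∈ ball) :
    ∑ r ∈ R, pullCoeff (d.act δ) (pullCoeff (d.act r) k) z = ∑ r ∈ R, pullCoeff (d.act r) k z := by
  have hunit : ∀ r ∈ R, IsUnitaryOf (conjE E) d.H r := by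
    intro r hr
    obtain ⟨a, ha, b, hb, rfl⟩ := hR.1 r hr
    exact ((hΓ'.isUnitaryOf ha).mul hg).mul (hΓ'.isUnitaryOf hb)
  have hδu : IsUnitaryOf (conjE E) d.H δ := hΓ'.isUnitaryOf hδ
  have hex : ∀ r ∈ R, ∃ r' ∈ R, ∃ γ ∈ Γ', r * δ = γ * r' := fun r hr => hR.exists_rep hΓ' hr hδ
  choose! σ hσR γf hγf hσ using hex
  have hterm : ∀ r ∈ R, pullCoeff (d.act δ) (pullCoeff (d.act r) k) z = pullCoeff (d.act (σ r)) k z := by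
    intro r hr
    rw [d.pullCoeff_act_act (hunit r hr) hδu k hz, hσ r hr,
      ← d.pullCoeff_act_act (hΓ'.isUnitaryOf (hγf r hr)) (hunit _ (hσR r hr)) k hz]
    have hinv := hk.2 _ (hγf r hr) _ (d.act_mem_ball_of_unitary (hunit _ (hσR r hr)) hz)
    simp only [pullCoeff] at hinv ⊢
    rw [hinv]
  rw [Finset.sum_congr rfl hterm]
  have hinj : ∀ r₁ ∈ R, ∀ r₂ ∈ R, σ r₁ = σ r₂ → r₁ = r₂ := by
    intro r₁ h₁ r₂ h₂ heq
    obtain ⟨γ₂', hγ₂', _, hγ₂'γ⟩ := hΓ'.exists_inv (hγf r₂ h₂)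
    obtain ⟨δ', _, hδδ', _⟩ := hΓ'.exists_inv hδ
    have h1 : r₁ * δ = γf r₁ * σ r₁ := hσ r₁ h₁
    have h2 : r₂ * δ = γf r₂ * σ r₂ := hσ r₂ h₂
    have h3 : σ r₂ = γ₂' * (r₂ * δ) := by rw [h2, ← Matrix.mul_assoc, hγ₂'γ, Matrix.one_mul]
    have h4 : r₁ * δ = (γf r₁ * γ₂') * (r₂ * δ) := by rw [h1, heq, h3, Matrix.mul_assoc]
    have h5 : r₁ = (γf r₁ * γ₂') * r₂ := by
      have := congrArg (fun m => m * δ') h4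
      simp only [Matrix.mul_assoc, hδδ', Matrix.mul_one] at this
      simpa [Matrix.mul_assoc] using this
    exact hR.unique hΓ' h₁ h₂ (hΓ'.mul_mem (hγf r₁ h₁) hγ₂') h5
  have hsurj : ∀ r' ∈ R, ∃ r ∈ R, σ r = r' := by
    intro r' hr'
    obtain ⟨r, hr, hrr'⟩ := Finset.surj_on_of_inj_on_of_card_le (fun r _ => σ r) (fun r hr => hσR r hr)
      (fun r₁ r₂ h₁ h₂ h => hinj r₁ h₁ r₂ h₂ h) le_rfl r' hr'
    exact ⟨r, hr, hrr'.symm⟩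
  exact Finset.sum_nbij σ (fun r hr => hσR r hr) (fun r₁ h₁ r₂ h₂ h => hinj r₁ h₁ r₂ h₂ h)
    (fun r' hr' => hsurj r' hr') (fun _ _ => rfl)

/-- **The Hecke sum of a `2`-form is `Γ′`-invariant on the ball** for a Hecke element of level `Γ′`. -/
theorem pullCoeff_act_heckeCoeffSum {Γ' : Set (Matrix (Fin 3) (Fin 3) E)}
    (hΓ' : IsCongruenceSubgroup (conjE E) d.H Γ') (ts : List (ℤ × Finset (Matrix (Fin 3) (Fin 3) E)))
    (hh : HeckeElement.IsFor (conjE E) d.H Γ' ⟨ts⟩) {k : (Fin 2 → ℂ) → ℂ} (hk : d.IsAutForm2 Γ' k)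
    {δ : Matrix (Fin 3) (Fin 3) E} (hδ : δ ∈ Γ') {z : Fin 2 → ℂ} (hz : z ∈ ball) :
    pullCoeff (d.act δ) (d.heckeCoeffSum ⟨ts⟩ k) z = d.heckeCoeffSum ⟨ts⟩ k z := by
  induction ts with
  | nil => simp [heckeCoeffSum, pullCoeff]
  | cons t ts ih =>
    have hh' : HeckeElement.IsFor (conjE E) d.H Γ' ⟨ts⟩ := fun t' ht' => hh t' (List.mem_cons_of_mem _ ht')
    rw [d.heckeCoeffSum_cons_fun, pullCoeff_add, Pi.add_apply, pullCoeff_zsmul, ih hh',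
      d.pullCoeff_act_finset_sum]
    obtain ⟨g, hg, hR⟩ := hh t List.mem_cons_self
    rw [d.pullCoeff_act_sum_reps hΓ' hg hR hk hδ hz]
    simp only [Pi.add_apply, Pi.smul_apply]

/-- **A Hecke element of level `Γ′` carries `2`-forms of `X_{Γ′}` to `2`-forms of `X_{Γ′}`.** -/
theorem heckeCoeff_isAutForm2 {Γ' : Set (Matrix (Fin 3) (Fin 3) E)} (hΓ' : IsCongruenceSubgroup (conjE E) d.H Γ')
    {h : HeckeElement E} (hh : h.IsFor (conjE E) d.H Γ') {k : (Fin 2 → ℂ) → ℂ} (hk : d.IsAutForm2 Γ' k) :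
    d.IsAutForm2 Γ' (d.heckeCoeff h k) := by
  refine ⟨fun z hz => d.heckeCoeff_of_not_mem h k hz, fun δ hδ z hz => ?_⟩
  have hδu : IsUnitaryOf (conjE E) d.H δ := hΓ'.isUnitaryOf hδ
  have hzδ : d.act δ z ∈ ball := d.act_mem_ball_of_unitary hδu hz
  rw [d.heckeCoeff_of_mem h k hz]
  have hpull : pullCoeff (d.act δ) (d.heckeCoeff h k) z = pullCoeff (d.act δ) (d.heckeCoeffSum h k) z := by
    simp only [pullCoeff]
    rw [d.heckeCoeff_of_mem h k hzδ]
  rw [hpull]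
  obtain ⟨ts⟩ := h
  exact d.pullCoeff_act_heckeCoeffSum hΓ' ts hh hk hδ hz

end TargetData

end Summit.Ventures.HodgeRepro.Tier4
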